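import Literature.Probability.RandomPlanarGeometry.SAWTriangularEndpointMonotone
import HarnessLib

/-!
# The detour surgery on walks of `𝕋` with a fixed endpoint: slot pairs of `S_N(x)` ≅ sharp-turn pairs of `S_{N+1}(x)`

Topic `Literature/Probability/RandomPlanarGeometry` (continues `SAWTriangularEndpointMonotone.lean`: the fixed-endpoint
family `triSLx N x`; `SAWTriangularDetourSurgery.lean`: `triSlots`, `triSharp`, `triIns`, `triDel`, the all-walk pair
bijection `sum_triSlotPairs_eq_sum_triSharpPairs` and its bookkeeping).  Source: N. Madras, G. Slade, *The Self-Avoiding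
Walk* (1993), §7.3, proof of Theorem 7.3.2 ((7.3.5)–(7.3.7): counting the pairs `(ω, site)` in two ways) and Theorem
7.3.2(c)/7.3.4(b) (the fixed-endpoint version, printed for `ℤ^d`).  The detour surgery of `𝕋` is INTERIOR (it inserts
or deletes a vertex strictly between the endpoints), so it acts on `S_N(x)` with no restriction on the slots or the
sharp turns — this file records that (the sibling of `SAWTriangularBridgeSurgery.lean` / `SAWTriangularHalfSpaceSurgery.lean`
with the trivial window).

## Contents (namespace `Literature.Probability.RandomPlanarGeometry.SAW`)

* `triIns_mem_triSLx`, `triDel_mem_triSLx` — the surgery keeps the endpoint;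
* `triSlotPairsX`, `triSharpPairsX`, `sum_triSlotPairsX`, `sum_triSharpPairsX`, and the pair bijection
  **`sum_triSlotPairsX_eq_sum_triSharpPairsX`**.
-/

noncomputable section

open Finset Function Literature.Probability.LatticeModels Literature.Probability.Percolation SimpleGraph
open scoped BigOperators

namespace Literature.Probability.RandomPlanarGeometry.SAW

variable {N : ℕ} {x : Site 2} {ω : List (Site 2)} {m : ℕ} {z : Site 2}

/-- A walk of `S_N(x)` is a walk of `S_N`. [cite: MadrasSlade1993, §1.1] -/
theorem triSL_of_mem_triSLx (h : ω ∈ triSLx N x) : ω ∈ triSL N := (mem_triSLx.1 h).1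

/-- Inserting a detour apex keeps the endpoint. [cite: MadrasSlade1993, §7.3 (proof of Theorem 7.3.2)] -/
theorem triIns_mem_triSLx (hω : ω ∈ triSLx N x) (hs : (m, z) ∈ triSlots ω) : triIns m z ω ∈ triSLx (N + 1) x := by
  obtain ⟨hωS, hωx⟩ := mem_triSLx.1 hω
  have hl := length_of_mem_triSL hωS
  obtain ⟨hm, -, -, -⟩ := mem_triSlots.1 hs
  refine mem_triSLx.2 ⟨triIns_mem_triSL hωS hs, ?_⟩
  rw [getD_triIns_of_lt (by omega : m + 1 < N + 1), Nat.add_sub_cancel, hωx]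

/-- Deleting the apex of a sharp turn keeps the endpoint. [cite: MadrasSlade1993, §7.3 (proof of Theorem 7.3.2)] -/
theorem triDel_mem_triSLx (hω : ω ∈ triSLx (N + 1) x) (hm : m ∈ triSharp ω) : triDel m ω ∈ triSLx N x := by
  obtain ⟨hωS, hωx⟩ := mem_triSLx.1 hω
  have hl := length_of_mem_triSL hωS
  obtain ⟨hml, -⟩ := mem_triSharp.1 hm
  refine mem_triSLx.2 ⟨triDel_mem_triSL hωS hm, ?_⟩
  rw [getD_triDel_of_lt (by omega : m < N), hωx]

/-! ### Counting the endpoint pairs in two ways -/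

/-- The slot pairs `(ω, (m, z))`, `ω ∈ S_N(x)`. [cite: MadrasSlade1993, §7.3 (proof of Theorem 7.3.2), (7.3.5)] -/
def triSlotPairsX (N : ℕ) (x : Site 2) : Finset (Σ _ : List (Site 2), ℕ × Site 2) :=
  (triSLx N x).sigma fun ω => triSlots ω

/-- The sharp-turn pairs `(ω, m)`, `ω ∈ S_N(x)`. [cite: MadrasSlade1993, §7.3 (proof of Theorem 7.3.2), (7.3.5)] -/
def triSharpPairsX (N : ℕ) (x : Site 2) : Finset (Σ _ : List (Site 2), ℕ) :=
  (triSLx N x).sigma fun ω => triSharp ω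

/-- Summing over slot pairs is summing `I(ω) · F(ω)`. [cite: MadrasSlade1993, §7.3] -/
theorem sum_triSlotPairsX (N : ℕ) (x : Site 2) (F : List (Site 2) → ℝ) :
    ∑ p ∈ triSlotPairsX N x, F p.1 = ∑ ω ∈ triSLx N x, (#(triSlots ω) : ℝ) * F ω := by
  rw [triSlotPairsX, Finset.sum_sigma]
  refine sum_congr rfl fun ω _ => ?_
  change ∑ s ∈ triSlots ω, F ω = _
  rw [sum_const, nsmul_eq_mul]

/-- Summing over sharp-turn pairs is summing `J(ω) · F(ω)`. [cite: MadrasSlade1993, §7.3] -/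
theorem sum_triSharpPairsX (N : ℕ) (x : Site 2) (F : List (Site 2) → ℝ) :
    ∑ q ∈ triSharpPairsX N x, F q.1 = ∑ ω ∈ triSLx N x, (#(triSharp ω) : ℝ) * F ω := by
  rw [triSharpPairsX, Finset.sum_sigma]
  refine sum_congr rfl fun ω _ => ?_
  change ∑ s ∈ triSharp ω, F ω = _
  rw [sum_const, nsmul_eq_mul]

/-- **Counting the endpoint pairs in two ways**: `(ω, (m, z)) ↦ (triIns m z ω, m)` is a bijection from the slot pairs of
`S_N(x)` onto the sharp-turn pairs of `S_{N+1}(x)` (inverse `(ω', m) ↦ (triDel m ω', (m, ω'_{m+1}))`).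
[cite: MadrasSlade1993, §7.3 (proof of Theorem 7.3.2), (7.3.5)–(7.3.6)] -/
theorem sum_triSlotPairsX_eq_sum_triSharpPairsX (N : ℕ) (x : Site 2) (F : (Σ _ : List (Site 2), ℕ × Site 2) → ℝ)
    (G : (Σ _ : List (Site 2), ℕ) → ℝ)
    (h : ∀ p ∈ triSlotPairsX N x, F p = G ⟨triIns p.2.1 p.2.2 p.1, p.2.1⟩) :
    ∑ p ∈ triSlotPairsX N x, F p = ∑ q ∈ triSharpPairsX (N + 1) x, G q := by
  refine Finset.sum_nbij' (fun p => ⟨triIns p.2.1 p.2.2 p.1, p.2.1⟩)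
    (fun q => ⟨triDel q.2 q.1, (q.2, q.1.getD (q.2 + 1) 0)⟩) ?_ ?_ ?_ ?_ h
  · rintro ⟨ω, m, z⟩ hp
    rw [triSlotPairsX, Finset.mem_sigma] at hp
    rw [triSharpPairsX, Finset.mem_sigma]
    exact ⟨triIns_mem_triSLx hp.1 hp.2, mem_triSharp_triIns (triSL_of_mem_triSLx hp.1) hp.2⟩
  · rintro ⟨ω, m⟩ hq
    rw [triSharpPairsX, Finset.mem_sigma] at hq
    rw [triSlotPairsX, Finset.mem_sigma]
    exact ⟨triDel_mem_triSLx hq.1 hq.2, mem_triSlots_triDel (triSL_of_mem_triSLx hq.1) hq.2⟩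
  · rintro ⟨ω, m, z⟩ hp
    rw [triSlotPairsX, Finset.mem_sigma] at hp
    dsimp only at hp
    obtain ⟨hm, -, -, -⟩ := mem_triSlots.1 hp.2
    dsimp only
    rw [triDel_triIns, getD_triIns_self (by omega)]
  · rintro ⟨ω, m⟩ hq
    rw [triSharpPairsX, Finset.mem_sigma] at hq
    dsimp only at hq
    obtain ⟨hml, -⟩ := mem_triSharp.1 hq.2
    dsimp only
    rw [triIns_triDel (by omega)]

end Literature.Probability.RandomPlanarGeometry.SAW
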